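import Summits.ResolutionOfSingularities.ResolutionOfSingularities.Theorems.MarkedTransferCampaignW46ThreefoldsGammaFreeGlobalLadder
import Literature.AlgebraicGeometry.Resolution.AlterationsCurves
import Literature.AlgebraicGeometry.Resolution.AlterationsBoundaryDivisor
import Literature.AlgebraicGeometry.Resolution.PointCentrePermissible
import Literature.AlgebraicGeometry.Resolution.ColonIdealSheafFG
import Literature.AlgebraicGeometry.Resolution.OrderSemicontinuity
import Literature.AlgebraicGeometry.Resolution.RegularLocalRingsNormal
import HarnessLib

/-!
# [OURS · L1 W4.6 rung (ii-1)] THE CURVE RUNG OF THE DIMENSION LADDER — `GammaFreeGlobalOrderReductionDimLE p 1`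
# (and the warm-up slice `d = 0`), PROVED: Γ-free global order reduction on regular integral curves

Cell res-hironaka, LADDER-RESOLUTION rung L (D-0089), slot W4.6 «restricted-regime rungs of the typed Th. 16.6 procedure»,
rung (ii) (threefold hypersurfaces) in the DIMENSION LADDER of the Γ-free global order-reduction statement (typer
res-L1-type-o1, `…ThreefoldsGammaFreeGlobalLadder.lean` p496755: `CampaignW46.OrderReducible I m`,
`CampaignW46.GammaFreeGlobalOrderReductionDimLE p d`; RUNG MAP `L/res-L1-type-o1/RUNG-MAP-W46.md` (ii-1) names THIS object for
seat res-L1-s46-pv-10 = res-D-pv-047 converted). Host route MarkedTransfer, host item `HypersurfaceOrderReductionDimLeThree`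
(stmt-ResolutionOfSingularities-16156); filed `--kind proof --supports` it `--as helper`. Everything here is OURS: kernel
theorems over the campaign definitions; NOTHING is a statement of Hironaka's manuscript; no typed `Hironaka2017` candidate
enters; no `Literature.…` named FACT is used as a hypothesis (only proved tree lemmas). AI-written; AI review is weaker than
expert review.

## What is proved

* `CampaignW46.gammaFreeGlobalDimLE_one (p) : GammaFreeGlobalOrderReductionDimLE p 1` — **for every perfect field `k` of
  characteristic `p`, every separated / locally-of-finite-type / quasi-compact / integral / regular `k`-scheme `X` of
  dimension `≤ 1`, every effective Cartier `I ≠ 0` and every `m ≥ 1`, the input `(X, I, m)` is order-reducible by a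
  sequence of permissible blowing-ups** (`OrderReducible I m`: `∃ X′ Φ J′, IsPermissibleBlowupSeq I m Φ J′ ∧ ∀ x, ord_x J′ < m`).
  The proof is the one the RUNG MAP prescribes: the locus `{x | ord_x I ≥ m}` lies in the support of `I`, a PROPER closed
  subset of the irreducible Noetherian curve `X` (`I ≠ 0`), hence a finite set of CLOSED points
  (`Set.finite_and_isClosed_singleton_of_dim_le_one`), at each of which the local ring is a discrete valuation ring
  (`isDiscreteValuationRing_stalk_of_dim_le_one`; regular local rings are normal, `isIntegrallyClosed_of_isRegularLocalRing`);
  the reduced closed point `{x}` is a regular centre (`isRegular_subscheme_vanishingIdeal_singleton`) whose ideal `𝓘_{x}` is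
  an EFFECTIVE CARTIER divisor (`𝓘_{x},x = 𝔪_x` principal; `isEffectiveCartier_of_stalkIdeal_eq_span_singleton`), so the
  identity `𝟙 X` IS the blowing up of `X` along it (`IsBlowup.id`, Görtz–Wedhorn remark after Def. 13.90) and the
  controlled transform `(I : 𝓘_{x}^m)` has stalk `𝔪_x^{v−m}` at `x` (`v = ord_x I ≥ m`) and the stalks of `I` elsewhere
  (`IsBlowup.stalkIdeal_controlledTransform`, colon computation in the DVR); induction on `v` at one point, then on the
  number of points of order `≥ m` (`OrderReducible.of_isPermissibleBlowupSeq`). The characteristic, the perfectness, the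
  separatedness and the Cartier hypothesis are not used (the binders are those of the ladder, byte-identical).
* `CampaignW46.orderReducible_of_dim_le_one` — the same for ANY integral Noetherian regular scheme of dimension `≤ 1` and any
  ideal `I ≠ 0`, `m ≥ 1` (no base field).
* `CampaignW46.gammaFreeGlobalDimLE_zero (p) : GammaFreeGlobalOrderReductionDimLE p 0` — the disclosed warm-up slice, by
  antitonicity of the ladder (`GammaFreeGlobalOrderReductionDimLE.of_le`).

HONEST VALUE. This is the `d = 1` rung only: order reduction of a nonzero ideal on a regular curve by «dividing out
`𝔪_x^m` at the finitely many points of order `≥ m`», each division being a permissible blowing-up in the sense of the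
campaign's `IsPermissibleBlowupSeq` (regular centre inside the order-`≥ m` locus of the WHOLE stage; the blow-up of a curve
at a Cartier point is the identity). It is a NON-VACUOUS unconditional inhabitant of the conclusion shape of the rung-(ii)
statement of record (`GammaFreeGlobalOrderReductionDimLeThree p`, `d = 3`, which stays open in the tree and is implied by
the host item); it says nothing about `d = 2, 3`, about the typed procedure's résumés, or about the manuscript.

References: `…ThreefoldsGammaFreeGlobalLadder.lean` (p496755), `…ThreefoldsGammaFreeGlobal.lean` (p493059); tree
`Resolution/Blowups.lean` (`IsBlowup.id`), `Resolution/ColonIdealSheafFG.lean` (`IsBlowup.stalkIdeal_controlledTransform`,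
Atiyah–Macdonald Cor. 3.15), `Resolution/AlterationsCurves.lean` (curves: finiteness of proper closed subsets, DVR stalks),
`Resolution/PointCentrePermissible.lean`, `Resolution/AlterationsBoundaryDivisor.lean`, `Resolution/OrderSemicontinuity.lean`,
`Resolution/RegularLocalRingsNormal.lean` (Matsumura Thm. 19.4). H. Hironaka, ms. 2017-03-23, §2.1 p.4, Def. 2.1 p.5,
Th. 16.13 p.87 — scope only, under adjudication, not cited as fact. [Hironaka2017]
-/

noncomputable section

set_option linter.dupNamespace false -- mandated namespace of this single-conjunct summit

open CategoryTheory AlgebraicGeometry TopologicalSpace IsLocalRing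

namespace Summit.ResolutionOfSingularities.ResolutionOfSingularities.Theorems

namespace CampaignW46

open Literature.AlgebraicGeometry.Resolution
open Scheme.IdealSheafData

universe u

/-! ## §1 Orders at a point whose local ring is a discrete valuation ring -/

section DVRPoint

variable {X : Scheme.{u}} {x : X}

/-- Ideal sheaves with the same stalk at `x` have the same order at `x` (the order is read on the stalk). [folklore] -/
theorem idealOrder_congr_stalkIdeal {I J : X.IdealSheafData} (h : stalkIdeal I x = stalkIdeal J x) :
    idealOrder I x = idealOrder J x := by
  refine ENat.eq_of_forall_natCast_le_iff fun n => ?_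
  rw [le_idealOrder_iff, le_idealOrder_iff, h]

/-- In a discrete valuation ring `𝒪_{X,x}`: if `I_x = 𝔪_x^n` then `ord_x(I) = n` (`𝔪_x^n ⊄ 𝔪_x^{n+1}`).
[cite: ZariskiSamuel1960, Vol. II Ch. VIII §1 (orders of ideals in local rings)] -/
theorem idealOrder_eq_of_stalkIdeal_eq_pow [IsDomain (X.presheaf.stalk x)]
    [IsDiscreteValuationRing (X.presheaf.stalk x)] {I : X.IdealSheafData} {n : ℕ}
    (hn : stalkIdeal I x = maximalIdeal (X.presheaf.stalk x) ^ n) : idealOrder I x = n := by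
  obtain ⟨ϖ, hϖ⟩ := IsDiscreteValuationRing.exists_irreducible (X.presheaf.stalk x)
  refine le_antisymm ?_ ((le_idealOrder_iff I x n).mpr (by rw [hn]))
  have hnot : ¬ ((n + 1 : ℕ) : ℕ∞) ≤ idealOrder I x := by
    rw [le_idealOrder_iff, hn, hϖ.maximalIdeal_eq, Ideal.span_singleton_pow, Ideal.span_singleton_pow,
      Ideal.span_singleton_le_span_singleton, pow_dvd_pow_iff hϖ.ne_zero hϖ.not_isUnit]
    omega
  rw [not_le] at hnot
  cases h : idealOrder I x with
  | top => rw [h] at hnot; exact absurd hnot (not_lt.mpr le_top)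
  | coe k =>
    rw [h] at hnot
    have : k < n + 1 := by exact_mod_cast hnot
    exact_mod_cast Nat.lt_succ_iff.mp this

/-- In a discrete valuation ring `𝒪_{X,x}` every nonzero stalk ideal is a power of the maximal ideal: `I_x = 𝔪_x^n` with
`n = ord_x(I)`. [cite: ZariskiSamuel1960, Vol. II Ch. VIII §1 (orders of ideals in local rings)] -/
theorem exists_stalkIdeal_eq_pow_of_dvr [IsDomain (X.presheaf.stalk x)]
    [IsDiscreteValuationRing (X.presheaf.stalk x)] (I : X.IdealSheafData) (hI : stalkIdeal I x ≠ ⊥) :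
    ∃ n : ℕ, stalkIdeal I x = maximalIdeal (X.presheaf.stalk x) ^ n ∧ idealOrder I x = n := by
  obtain ⟨ϖ, hϖ⟩ := IsDiscreteValuationRing.exists_irreducible (X.presheaf.stalk x)
  obtain ⟨n, hn⟩ := IsDiscreteValuationRing.ideal_eq_span_pow_irreducible hI hϖ
  have hmax : stalkIdeal I x = maximalIdeal (X.presheaf.stalk x) ^ n := by
    rw [hn, hϖ.maximalIdeal_eq, Ideal.span_singleton_pow]
  exact ⟨n, hmax, idealOrder_eq_of_stalkIdeal_eq_pow hmax⟩

/-- **The colon computation in a discrete valuation ring**: `(𝔪^v : 𝔪^m) = 𝔪^{v−m}` for `m ≤ v` (with a uniformizer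
`ϖ`: `z·ϖ^m ∈ (ϖ^v) ↔ ϖ^{v−m} ∣ z`). [cite: ZariskiSamuel1960, Vol. II Ch. VIII §1 (orders of ideals in local rings)] -/
theorem colon_maximalIdeal_pow_of_dvr {R : Type u} [CommRing R] [IsDomain R] [IsDiscreteValuationRing R]
    {m v : ℕ} (hmv : m ≤ v) :
    Submodule.colon (maximalIdeal R ^ v) ((maximalIdeal R ^ m : Ideal R) : Set R) = maximalIdeal R ^ (v - m) := by
  obtain ⟨k, rfl⟩ := Nat.exists_eq_add_of_le hmv
  rw [Nat.add_sub_cancel_left]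
  obtain ⟨ϖ, hϖ⟩ := IsDiscreteValuationRing.exists_irreducible R
  have hϖm : ϖ ^ m ≠ 0 := pow_ne_zero m hϖ.ne_zero
  rw [hϖ.maximalIdeal_eq, Ideal.span_singleton_pow, Ideal.span_singleton_pow, Ideal.span_singleton_pow]
  ext z
  rw [Submodule.mem_colon, Ideal.mem_span_singleton]
  constructor
  · intro h
    have hz : z * ϖ ^ m ∈ Ideal.span {ϖ ^ (m + k)} := h (ϖ ^ m) (Ideal.mem_span_singleton_self _)
    rw [Ideal.mem_span_singleton, pow_add, mul_comm z (ϖ ^ m)] at hz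
    exact (mul_dvd_mul_iff_left hϖm).mp hz
  · intro hz s hs
    rw [SetLike.mem_coe, Ideal.mem_span_singleton] at hs
    obtain ⟨a, rfl⟩ := hz
    obtain ⟨b, rfl⟩ := hs
    rw [smul_eq_mul, Ideal.mem_span_singleton, pow_add]
    exact ⟨a * b, by ring⟩

end DVRPoint

/-! ## §2 One permissible step at a closed point with DVR local ring: the identity blow-up -/

section PointStep

variable {X : Scheme.{u}} [IsIntegral X] [IsLocallyNoetherian X]

/-- **The reduced closed point `{x}` with `𝒪_{X,x}` a DVR is an effective Cartier divisor** (its ideal sheaf has the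
principal non-zero stalk `𝔪_x` at its only support point; Stacks 01WS through `isEffectiveCartier_of_stalkIdeal_eq_span_singleton`).
[cite: StacksProject, Tag 01WS] -/
theorem isEffectiveCartier_vanishingIdeal_singleton_of_dvr {x : X} (hx : IsClosed ({x} : Set X))
    [IsDiscreteValuationRing (X.presheaf.stalk x)] :
    IsEffectiveCartier (vanishingIdeal (⟨{x}, hx⟩ : Closeds X)) := by
  refine isEffectiveCartier_of_stalkIdeal_eq_span_singleton fun w hw => ?_
  have hw' : w ∈ ((vanishingIdeal (⟨{x}, hx⟩ : Closeds X)).support : Set X) := hw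
  rw [coe_support_vanishingIdeal] at hw'
  have hwx : w = x := hw'
  subst hwx
  obtain ⟨ϖ, hϖ⟩ := IsDiscreteValuationRing.exists_irreducible (X.presheaf.stalk w)
  exact ⟨ϖ, hϖ.ne_zero, by rw [stalkIdeal_vanishingIdeal_singleton hx, hϖ.maximalIdeal_eq]⟩

omit [IsIntegral X] [IsLocallyNoetherian X] in
/-- Off the closed point `x`, the ideal sheaf of `{x}` has unit stalks. [folklore] -/
theorem stalkIdeal_vanishingIdeal_singleton_of_ne {x y : X} (hx : IsClosed ({x} : Set X)) (hy : y ≠ x) :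
    stalkIdeal (vanishingIdeal (⟨{x}, hx⟩ : Closeds X)) y = ⊤ := by
  by_contra hne
  have hle : stalkIdeal (vanishingIdeal (⟨{x}, hx⟩ : Closeds X)) y ≤ maximalIdeal _ := IsLocalRing.le_maximalIdeal hne
  have hy' : y ∈ ((vanishingIdeal (⟨{x}, hx⟩ : Closeds X)).support : Set X) :=
    (mem_support_iff_stalkIdeal_le _ y).mpr hle
  rw [coe_support_vanishingIdeal] at hy'
  exact hy hy'

/-- Colon by the unit ideal changes nothing: `(L : R) = L`. [folklore] -/
theorem colon_top_set {R : Type u} [CommRing R] (L : Ideal R) : Submodule.colon L ((⊤ : Ideal R) : Set R) = L := by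
  ext z
  rw [Submodule.mem_colon]
  constructor
  · intro h
    simpa using h 1 trivial
  · intro hz s _
    rw [smul_eq_mul]
    exact Ideal.mul_mem_right s L hz

/-- **ONE PERMISSIBLE STEP AT A POINT OF ORDER `v ≥ m`.** Let `x` be a closed point of the integral locally Noetherian
scheme `X` with `𝒪_{X,x}` a discrete valuation ring and `I_x = 𝔪_x^v`, `m ≤ v`. Then the identity `𝟙 X`, read as the
blowing up of `X` along the effective Cartier centre `{x}` (`IsBlowup.id`), is a sequence of permissible blowing-ups of
length one for `(I, m)` with last transform `J₁ := (I : 𝓘_{x}^m)` (the controlled transform), and `J₁,x = 𝔪_x^{v−m}`,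
`J₁,y = I_y` for `y ≠ x`, `I ⊆ J₁`. [folklore] -/
theorem step_at_point {x : X} (hx : IsClosed ({x} : Set X)) [IsDiscreteValuationRing (X.presheaf.stalk x)]
    {I : X.IdealSheafData} {m v : ℕ} (hv : stalkIdeal I x = maximalIdeal (X.presheaf.stalk x) ^ v) (hmv : m ≤ v) :
    IsPermissibleBlowupSeq I m (𝟙 X) (controlledTransform (𝟙 X) (vanishingIdeal (⟨{x}, hx⟩ : Closeds X)) I m) ∧
      stalkIdeal (controlledTransform (𝟙 X) (vanishingIdeal (⟨{x}, hx⟩ : Closeds X)) I m) x =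
        maximalIdeal (X.presheaf.stalk x) ^ (v - m) ∧
      (∀ y : X, y ≠ x →
        stalkIdeal (controlledTransform (𝟙 X) (vanishingIdeal (⟨{x}, hx⟩ : Closeds X)) I m) y = stalkIdeal I y) ∧
      I ≤ controlledTransform (𝟙 X) (vanishingIdeal (⟨{x}, hx⟩ : Closeds X)) I m := by
  set D : Closeds X := ⟨{x}, hx⟩ with hD
  have hcart : IsEffectiveCartier (vanishingIdeal D) := isEffectiveCartier_vanishingIdeal_singleton_of_dvr hx
  have hπ : IsBlowup (𝟙 X) (vanishingIdeal D) := IsBlowup.id hcart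
  have hordx : idealOrder I x = v := idealOrder_eq_of_stalkIdeal_eq_pow hv
  refine ⟨?_, ?_, ?_, ?_⟩
  · refine IsPermissibleBlowupSeq.single D (𝟙 X) (isRegular_subscheme_vanishingIdeal_singleton hx) ?_ hπ
    intro y hy
    have hyx : y = x := hy
    subst hyx
    rw [hordx]
    exact_mod_cast hmv
  · rw [hπ.stalkIdeal_controlledTransform I m x, comap_id, comap_id, hv, stalkIdeal_vanishingIdeal_singleton hx]
    exact colon_maximalIdeal_pow_of_dvr hmv
  · intro y hy
    rw [hπ.stalkIdeal_controlledTransform I m y, comap_id, comap_id, stalkIdeal_vanishingIdeal_singleton_of_ne hx hy,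
      Ideal.top_pow]
    exact colon_top_set _
  · have h := comap_le_controlledTransform (𝟙 X) (vanishingIdeal D) I m
    rwa [comap_id] at h

/-- **ORDER REDUCTION AT ONE POINT.** With `x`, `X` as in `step_at_point` and `I_x = 𝔪_x^v`, `m ≥ 1`: finitely many
identity steps at `x` (`⌊v/m⌋` of them) produce a sequence of permissible blowing-ups `𝟙 X, J′` for `(I, m)` with
`ord_x J′ < m`, the stalks of `I` unchanged elsewhere and `I ⊆ J′`. Induction on `v`. [folklore] -/
theorem reduce_at_point {x : X} (hx : IsClosed ({x} : Set X)) [IsDiscreteValuationRing (X.presheaf.stalk x)]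
    {m : ℕ} (hm : 1 ≤ m) :
    ∀ (v : ℕ) (I : X.IdealSheafData), stalkIdeal I x = maximalIdeal (X.presheaf.stalk x) ^ v →
      ∃ J' : X.IdealSheafData, IsPermissibleBlowupSeq I m (𝟙 X) J' ∧ idealOrder J' x < m ∧
        (∀ y : X, y ≠ x → stalkIdeal J' y = stalkIdeal I y) ∧ I ≤ J' := by
  intro v
  induction v using Nat.strong_induction_on with
  | _ v ih =>
    intro I hv
    by_cases hlt : v < m
    · refine ⟨I, IsPermissibleBlowupSeq.nil, ?_, fun _ _ => rfl, le_rfl⟩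
      rw [idealOrder_eq_of_stalkIdeal_eq_pow hv]
      exact_mod_cast hlt
    · have hmv : m ≤ v := not_lt.mp hlt
      obtain ⟨hseq₁, hx₁, hy₁, hle₁⟩ := step_at_point hx hv hmv
      obtain ⟨J', hseq, hord, hy, hle⟩ := ih (v - m) (by omega) _ hx₁
      refine ⟨J', ?_, hord, fun y hyx => (hy y hyx).trans (hy₁ y hyx), hle₁.trans hle⟩
      have h := hseq₁.comp hseq
      rwa [Category.comp_id] at h

end PointStep

/-! ## §3 Order reduction on a regular integral Noetherian curve -/

section Curve

variable {X : Scheme.{u}} [IsIntegral X] [IsLocallyNoetherian X] [CompactSpace X]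

/-- **Γ-FREE ORDER REDUCTION ON A REGULAR CURVE** (no base field): for an integral Noetherian regular scheme `X` with
`topologicalKrullDim X ≤ 1`, an ideal `I ≠ 0` and `m ≥ 1`, the input `(X, I, m)` is order-reducible by permissible
blowing-ups (`OrderReducible I m`) — all the blowing-ups being the identity of `X` read as the blow-up along a closed
point, and the final ideal being `I` divided by the appropriate powers of the maximal ideals of the finitely many points
of order `≥ m`. [folklore] -/
theorem orderReducible_of_dim_le_one (hreg : Scheme.IsRegular X) (hdim : topologicalKrullDim X ≤ 1)
    {I : X.IdealSheafData} (hI : I ≠ ⊥) {m : ℕ} (hm : 1 ≤ m) : OrderReducible I m := by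
  haveI : IsNoetherian X := {}
  -- the locus of order `≥ m` of an ideal
  let S : X.IdealSheafData → Set X := fun J => {y | (m : ℕ∞) ≤ idealOrder J y}
  -- it lies in the support, a proper closed subset: finite, made of closed points with DVR local rings
  have hS_sub : ∀ J : X.IdealSheafData, S J ⊆ (J.support : Set X) := by
    intro J y hy
    have h1 : (1 : ℕ∞) ≤ idealOrder J y := le_trans (by exact_mod_cast hm) hy
    exact (one_le_idealOrder_iff J y).mp h1
  have hsupp_ne : ∀ J : X.IdealSheafData, J ≠ ⊥ → (J.support : Set X) ≠ Set.univ := by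
    intro J hJ h
    apply hJ
    rw [← support_eq_top_iff]
    exact Closeds.ext (by simpa using h)
  have hfin : ∀ J : X.IdealSheafData, J ≠ ⊥ → (S J).Finite ∧ ∀ y ∈ S J, IsClosed ({y} : Set X) := by
    intro J hJ
    obtain ⟨hf, hcl⟩ := Set.finite_and_isClosed_singleton_of_dim_le_one hdim J.support.isClosed (hsupp_ne J hJ)
    exact ⟨hf.subset (hS_sub J), fun y hy => hcl y (hS_sub J hy)⟩
  have hdvr : ∀ J : X.IdealSheafData, J ≠ ⊥ → ∀ y ∈ S J, IsDiscreteValuationRing (X.presheaf.stalk y) := by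
    intro J hJ y hy
    have hyη : y ≠ genericPoint X := by
      intro hyη
      apply hsupp_ne J hJ
      have hmem : genericPoint X ∈ (J.support : Set X) := hyη ▸ hS_sub J hy
      exact Set.eq_univ_of_univ_subset
        (((genericPoint_spec X).mem_closed_set_iff J.support.isClosed).mp hmem)
    exact isDiscreteValuationRing_stalk_of_dim_le_one
      (fun z => by haveI := hreg z; exact isIntegrallyClosed_of_isRegularLocalRing _) hdim hyη
  -- induction on the number of points of order `≥ m`
  suffices key : ∀ (n : ℕ) (J : X.IdealSheafData), J ≠ ⊥ → (S J).ncard ≤ n → OrderReducible J m from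
    key _ I hI le_rfl
  intro n
  induction n with
  | zero =>
    intro J hJ hcard
    have hempty : S J = ∅ := (Set.ncard_eq_zero (hfin J hJ).1).mp (Nat.le_zero.mp hcard)
    refine OrderReducible.of_forall_lt fun y => ?_
    by_contra hy
    have : y ∈ S J := not_lt.mp hy
    rw [hempty] at this
    exact this
  | succ n ih =>
    intro J hJ hcard
    by_cases hempty : S J = ∅
    · refine OrderReducible.of_forall_lt fun y => ?_
      by_contra hy
      have : y ∈ S J := not_lt.mp hy
      rw [hempty] at this
      exact this
    obtain ⟨x, hxS⟩ := Set.nonempty_iff_ne_empty.mpr hempty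
    have hx : IsClosed ({x} : Set X) := (hfin J hJ).2 x hxS
    haveI : IsDiscreteValuationRing (X.presheaf.stalk x) := hdvr J hJ x hxS
    obtain ⟨v, hv, -⟩ := exists_stalkIdeal_eq_pow_of_dvr J (stalkIdeal_ne_bot_of_ne_bot hJ x)
    obtain ⟨J', hseq, hord, hy, hle⟩ := reduce_at_point hx hm v J hv
    have hJ' : J' ≠ ⊥ := by
      intro h
      apply hJ
      rw [h] at hle
      exact le_bot_iff.mp hle
    -- the points of order `≥ m` of `J′` are those of `J` other than `x`
    have hS' : S J' ⊆ S J \ {x} := by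
      intro y hy'
      have hyx : y ≠ x := by
        rintro rfl
        exact absurd hy' (not_le.mpr hord)
      refine ⟨?_, hyx⟩
      change (m : ℕ∞) ≤ idealOrder J y
      rw [← idealOrder_congr_stalkIdeal (hy y hyx)]
      exact hy'
    have hcard' : (S J').ncard ≤ n := by
      have h1 : (S J').ncard ≤ (S J \ {x}).ncard := Set.ncard_le_ncard hS' ((hfin J hJ).1.sdiff)
      have h2 : (S J \ {x}).ncard = (S J).ncard - 1 := Set.ncard_sdiff_singleton_of_mem hxS
      omega
    exact OrderReducible.of_isPermissibleBlowupSeq hseq (ih J' hJ' hcard')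

end Curve

/-! ## §4 The rungs `d = 1` and `d = 0` of the ladder -/

/-- **RUNG `d = 1` OF THE DIMENSION LADDER, PROVED** (RUNG MAP (ii-1), the object named for res-L1-s46-pv-10): Γ-free
global order reduction holds for every input `(X, I, m)` of the ladder with `topologicalKrullDim X ≤ 1` — regular integral
curves (and points) of finite type over a perfect field of characteristic `p`. By `orderReducible_of_dim_le_one`; the
characteristic, perfectness, separatedness and the Cartier hypothesis on `I` are not used. NOT a statement of the
manuscript. [folklore] -/
theorem gammaFreeGlobalDimLE_one (p : ℕ) : GammaFreeGlobalOrderReductionDimLE.{u} p 1 := by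
  intro _ k _ _ _ X s _ hloft hqc hint hreg hdim I hI _ m hm
  haveI := hloft
  haveI := hqc
  haveI := hint
  haveI : IsLocallyNoetherian X := LocallyOfFiniteType.isLocallyNoetherian s
  haveI : CompactSpace X := QuasiCompact.compactSpace_of_compactSpace s
  exact orderReducible_of_dim_le_one hreg (by exact_mod_cast hdim) hI hm

/-- **RUNG `d = 0`** (the disclosed warm-up slice of the ladder), from `d = 1` by antitonicity. NOT a statement of the
manuscript. [folklore] -/
theorem gammaFreeGlobalDimLE_zero (p : ℕ) : GammaFreeGlobalOrderReductionDimLE.{u} p 0 :=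
  GammaFreeGlobalOrderReductionDimLE.of_le (Nat.zero_le 1) (gammaFreeGlobalDimLE_one p)

end CampaignW46

end Summit.ResolutionOfSingularities.ResolutionOfSingularities.Theorems

end
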